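import Literature.MathematicalPhysics.QuantumFieldTheory.Balaban1983to89.Node00.OpsYDeltaPrimeA
import Literature.MathematicalPhysics.QuantumFieldTheory.Balaban1983to89.B9Thm31CubeLocalFlat

/-!
# `Balaban1983to89.B9CubeLettersOpsL0` — THE CUBE-LOCAL COVARIANT OPERATOR `Δ′_{a,□}(U)` AND THE LETTER `G′_□(U) = (Δ′_{a,□}(U))⁻¹`
# OF [B9] SECT. C (p. 409) IN def-Y's CURRENCY: `Node00.OpsYDeltaPrimeA` §3–§4 RE-INSTANTIATED AT THE CUBE FAMILY OF `B9CubeSequence408`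
# (levels `min(D.lev, prof_□)`, weights `B9Thm31CubeLocalFlat.wCube`), the printed `U = 1` clauses, and THE ROW AGREEMENT WITH `Δ′_a(U)` NEAR □
# (sub-row G-B9-LETTERS, module M5.1c; r06 ruling `B9-LETTERS-MAP.md` v1.2 §9 Q2)

FRAMING (verbatim cell line):
statement-level skeleton of published theorems with citation tags; proofs where landed; nothing here is a claim about the Yang–Mills mass gap

Sources under audit (cell lit-balaban): T. Bałaban, *Propagators for lattice gauge theories in a background field*, Commun. Math. Phys. **99**
(1985) 389–434 [`Balaban1985BackgroundPropagators`, "B9"], (3.19) p. 393, (3.23)–(3.25) pp. 394–395, Cor. 3.5 p. 407, Sect. C pp. 408–409,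
(3.87)–(3.88) p. 409; T. Bałaban, *Propagators and renormalization transformations for lattice gauge theories. II*, Commun. Math. Phys. **96**
(1984) 223–250 [`Balaban1984PropagatorsII`, "[4]"], (2.13)–(2.14) p. 225.  Unit `lit-balaban-r05` (r05 gen 77); B9 fold owner r06, def-Y =
`pub-ymgap-node00-def-Y` (the `Node00.OpsY*` functors), p21 = the consumer (`B9CubeLettersInvReadings`, `B9.Thms31to33IneqAt`).

## WHAT IS PRINTED (verbatim up to notation)

[B9] p. 409 l. 1–5: «the sequence {Ω_n(□)} satisfies the assumptions of Corollary 3.6. The operators constructed for this sequence, which we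
denote by G′_□(U), C_□(U) = (Q′(U)G′_□²(U)Q′*(U))⁻¹, G_□(U), satisfy all the inequalities of Theorems 3.1–3.3 correspondingly.»  p. 394 (3.24):
«Δ′_a = Δ′_a(U) = (Δ_{η,U} + Q′*aQ′)|_{Ω₀} … ⟨λ, Q′*aQ′λ⟩ = Σ_{j=0}^{k} a_j Σ_{y∈Λ_j} (L^jη)^{d−2}|(Q′_j(U)λ)(y)|²»; p. 395: «Its inverse is
denoted by G′, or G′(U) … It coincides with Δ_a in (2.19) if U = 1»; p. 409 (3.87)–(3.88): «G′₀ = Σ_□ h_□G′_□h_□ … (Δ′_a hλ)(x) = h(x)(Δ′_aλ)(x) −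
(K(h)λ)(x) … hence Δ′_aG′₀ = I − Σ_□ K(h_□)G′_□h_□» — which uses `Δ′_a G′_□ h_□λ = h_□λ` on `supp h_□`, i.e. THE ROWS OF `Δ′_a` AND `Δ′_{a,□}`
COINCIDE THERE.

## WHAT THIS FILE DEFINES AND CERTIFIES (kernel-checked; def-Y's carrier `SiteY i`, index `i : B6KLevelCensusIndexV1.KIdx`)

Nothing of def-Y's is restated: carriers, `liftOpY ∕ liftY`, `lapSL`, `kernelTrOpY`, `cornerY`, `levY`, `avgCoeffY ∕ avgTrY ∕ deltaPrimeAY`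
are `Node00`'s own; this file changes ONE input — the level function (and, with it, the weights):
* §1 `cubeFamY i q` = file 1's `cubeFam (toKT i).D q …` (def-Y's index supplies odd `L`, odd `M_h = Lᵃ`, `M_h ≥ 1`, `P ≥ 1`), `levCubeY i q z`.
* §2 ★ `avgCoeffCubeY i q z w := avgK (levC d L wCube (lev_□ z)) (L^{lev_□ z}) z w`, `avgTrCubeY i q par U z w := U(Γ_{z,c})U(Γ_{c,w})` through
  the corner `c` of the `L^{lev_□ z}`-block (def-Y's `avgTrY` with `lev_□`), ★★ `deltaPrimeACubeY i q par U := lapSL i U + kernelTrOpY (avgCoeffCubeY i q)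
  (avgTrCubeY i q par U)` = `Δ′_{a,□}(U)`; its floor rows (`lev_□ z = 0`): `Δ_UΛ(z) + R(U(Γ_{z,z})²)Λ(z)` (unit mass, «(Q′₀λ)(x) = λ(x)»).
* §3 ★★ THE PRINTED `U = 1` CLAUSES: `deltaPrimeACubeY_one : Δ′_{a,□}(1) = liftOpY (mlOpT … lev_□ wCube)` (under `par 1 = 1`), `isUnit`, the
  GENUINE LETTER `GpCubeY i q par : SiteOpY 𝔸 i := fun U => Ring.inverse (Δ′_{a,□}(U))` (p21's slot type) with the inverse laws under
  `IsUnit (Δ′_{a,□}(U))`, and ★★ `GpCubeY_one : G′_□(1) = liftOpY (GpCubeW …)` (file 2's matrix `gmlT … lev_□ wCube`), `GpCubeY_one_liftY`.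
* §4 ★★ THE ROW AGREEMENT (the `hloc` input of (3.88)): for `z` near □ (`B9CubeSequence408.NearH q z` — the `3^{d+1}` big blocks around the
  parent block of □, ⊇ □³ ⊇ supp h_□) and EVERY `par, U, Λ`: `lev_□ z = lev z`, `avgCoeffCubeY i q z = avgCoeffY i z`, `avgTrCubeY … z = avgTrY … z`,
  hence `deltaPrimeACubeY i q par U Λ z = deltaPrimeAY i par U Λ z`, and the cut-off form `h·(Δ′_{a,□}(U)Λ) = h·(Δ′_a(U)Λ)` for `supp h ⊂ NearH`.
  (This is WHY the weights are `wCube`: def-Y's `Δ′_a` carries print's `a_j` at a level `j ≥ 1`; see file 2 v1.1 §4.)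

v1.1 (same gen; DOCSTRINGS ONLY, code byte-identical to v1 p595976): r06 LANDING SWEEP №5 — (3.25) is p.394; floor-rows docstring names
print's `a₀η⁻²`-mass ((3.24) p.394 «a_1 = a_0 = a > 0», r06 PAGE CHECK u.458 (4)).

## HONEST SCOPE

* def-Y's HONEST LIMITS (`Node00.OpsYDeltaPrimeA`) apply verbatim: corner reference point, `par`'s contour, no `Ω₀`-restriction; here in
  addition file 1's: the cube sequence is realised on the member's own torus with a mass-`a = 1` floor instead of print's Dirichlet
  restriction to `Ω₀(□)` (ruling (R)), single scale.  At `U = 1` the letter IS `gmlT(cubeFam, wCube)`, for which file 2 v1.1 certifies the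
  Thm 3.1 (3.42) sup entries and Thm 3.2 — THIS file proves no inequality.
* Invertibility of `Δ′_{a,□}(U)` for `U` in the class (3.35) is Thm 3.1's content for the cube letters (Cor. 3.6) and is NOT proved here
  (`GpCubeY` is `Ring.inverse`, `= 0` off the invertible set); proved at `U = 1` only.
* Site sector only (`G′_□`); the bond-sector cube letters `G_□(U)` (def-Y's `OpsYDeltaA` at the cube family) and `C_□(U)` are the next file.
* Nothing is inferred from the manuscript; every `theorem` is kernel-checked algebra over def-Y's definitions.  NOT summit progress; the YM mass
  gap is not proved by any of this (Track A conditional rung).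
-/

namespace Literature.MathematicalPhysics.QuantumFieldTheory.Balaban1983to89.B9CubeLettersOpsL0

open Node00
open B4Reflection242 (boxDom avgK blk)
open B4Lemma24ZeroBoxAlphaNeg (blk_one)
open B6MultiLevelBoxOperator (levC aPrinted N0)
open B6MultiLevelBoxOperatorL0 (levC_zero)
open B6MultiLevelTorusOperator (mlOpT gmlT perLapT)
open B6KLevelCensusIndexV1 (KIdx)
open B6Cover236MultiLevelBlocks (cubes)
open B9Eq39Adjoint (R R_mul)
open B9Cor35AtOneInverseLetters (eq_liftOpY_of_ringInverse isUnit_of_liftY_clause_mulVec clause_of_ringInverse_mulVec one_le_ell)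
open B9CubeSequence408 (cubeFam NearH lev_cubeFam_eq_of_nearH lev_cubeFam_le)
open B9Thm31CubeLocalFlat (wCube wCube_of_one_le wCube_zero GpCubeW mlOpT_mul_GpCubeW)
open scoped Matrix

noncomputable section

variable {d ℓ : ℕ} {hd : 1 ≤ d + 1} {hL : Odd (ℓ + 1) ∧ 1 < ℓ + 1} {b₀ b₁ : ℝ}
variable {𝔸 : Type} [NormedRing 𝔸] [NormedAlgebra ℂ 𝔸] [CompleteSpace 𝔸]

/-! ## §1 The cube family at def-Y's index -/

section Index

variable (i : KIdx d ℓ hd hL b₀ b₁)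

/-- `M_h = Lᵃ` is odd (odd `L`). [cite: Balaban1984PropagatorsII, (2.1) p.224, bookkeeping] -/
theorem oddMh : Odd (toKT i).Mh := by
  show Odd i.Mh
  rw [i.hMha]; exact hL.1.pow

/-- `R ≥ 2` (from `R ≥ 2L²`). [cite: Balaban1984PropagatorsII, (2.2) p.224, bookkeeping] -/
theorem two_le_R : 2 ≤ (toKT i).R := by have := (toKT i).hR; omega

/-- **THE CUBE FAMILY `{Ω_n(□)}` OF def-Y's MEMBER AT A COVER CUBE** — file 1's `cubeFam` at `(toKT i).D` (levels `min(D.lev, prof_□)`).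
[cite: Balaban1985BackgroundPropagators, p.408 («a sequence {Ω_n(□)}_{n=0,…,j+1} of domains»), dictionary] -/
def cubeFamY (q : ↥(cubes (toKT i).D.toDomains)) :
    B6MultiLevelTorusOperatorL0.TDomains d ℓ (toKT i).Mh (toKT i).k (toKT i).P (toKT i).R :=
  cubeFam (toKT i).D q hL.1 (oddMh i) (toKT i).hMh (toKT i).hP

/-- the cube family's level `lev_□ z` of a site of the box chart. [cite: Balaban1985BackgroundPropagators, p.408, dictionary] -/
abbrev levCubeY (q : ↥(cubes (toKT i).D.toDomains)) (z : SiteY i) : ℕ := (cubeFamY i q).lev z.1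

/-- `lev_□ ≤ lev`. [cite: Balaban1985BackgroundPropagators, p.408 (Ω_n(□) ⊂ Ω_n), bookkeeping] -/
theorem levCubeY_le_levY (q : ↥(cubes (toKT i).D.toDomains)) (z : SiteY i) : levCubeY i q z ≤ levY i z :=
  lev_cubeFam_le z.1

end Index

/-! ## §2 The cube-local covariant operator `Δ′_{a,□}(U)` -/

section DeltaPrime

variable (i : KIdx d ℓ hd hL b₀ b₁) (q : ↥(cubes (toKT i).D.toDomains))

/-- ★ THE AVERAGING COEFFICIENT OF THE CUBE SEQUENCE: `levC_{lev_□ z}·[w ∼_{lev_□ z} z]` with the weights `wCube` (`a = 1` on the floor, print's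
`a_j` at a level `j ≥ 1`) — def-Y's `avgCoeffY` with `lev_□` for `lev`. [cite: Balaban1984PropagatorsII, (2.13)–(2.14) p.225; Balaban1985BackgroundPropagators, (3.24) p.394, p.409] -/
def avgCoeffCubeY (z w : SiteY i) : ℝ :=
  avgK (levC d ℓ (wCube ℓ) (levCubeY i q z)) ((ℓ + 1) ^ levCubeY i q z) z.1 w.1

/-- ★ THE TRANSPORTER OF THE CUBE SEQUENCE'S AVERAGING TERM: `U(Γ_{z,c})·U(Γ_{c,w})` through the corner `c` of the common `L^{lev_□ z}`-block —
def-Y's `avgTrY` with `lev_□` for `lev`. [cite: Balaban1985BackgroundPropagators, (3.19) p.393, (3.24) p.394, p.409] -/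
def avgTrCubeY (par : SiteParY 𝔸 i) (U : CfgY 𝔸 i) (z w : SiteY i) : 𝔸ˣ :=
  par U z (cornerY i (levCubeY i q z) z) * par U (cornerY i (levCubeY i q z) z) w

/-- at `U = 1` (transporters `= 1`) the averaging transporter is `1`. [cite: Balaban1985BackgroundPropagators, Cor. 3.5 p.407 (U = 1), bookkeeping] -/
theorem avgTrCubeY_one (par : SiteParY 𝔸 i) (hpar : ∀ z w, par (fun _ _ => 1) z w = 1) (z w : SiteY i) :
    avgTrCubeY i q par (fun _ _ => 1) z w = 1 := by
  rw [avgTrCubeY, hpar, hpar, mul_one]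

/-- ★★ **THE CUBE-LOCAL COVARIANT OPERATOR `Δ′_{a,□}(U)`** — (3.24) «constructed for the sequence {Ω_n(□)}» (p. 409): the covariant Laplacian plus
the transported averaging kernel of the cube sequence; def-Y's `deltaPrimeAY` with `lev_□` for `lev`.
[cite: Balaban1985BackgroundPropagators, (3.24) p.394, p.409 («G′_□(U)»); Balaban1984PropagatorsII, (2.13)–(2.14) p.225] -/
def deltaPrimeACubeY (par : SiteParY 𝔸 i) (U : CfgY 𝔸 i) : (SiteY i → 𝔸) →ₗ[ℂ] (SiteY i → 𝔸) :=
  lapSL i U + kernelTrOpY (avgCoeffCubeY i q) (avgTrCubeY i q par U)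

/-- `Δ′_{a,□}(U)`, evaluated. [cite: Balaban1985BackgroundPropagators, (3.24) p.394, bookkeeping] -/
theorem deltaPrimeACubeY_apply (par : SiteParY 𝔸 i) (U : CfgY 𝔸 i) (Λ : SiteY i → 𝔸) (z : SiteY i) :
    deltaPrimeACubeY i q par U Λ z =
      lapS i U Λ z + ∑ w, ((avgCoeffCubeY i q z w : ℝ) : ℂ) • R (avgTrCubeY i q par U z w) (Λ w) := rfl

/-- on the floor the corner is the site itself (`L⁰`-blocks are points). [cite: Balaban1985BackgroundPropagators, (3.19) p.393, bookkeeping] -/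
theorem cornerY_zero (z : SiteY i) : cornerY i 0 z = z := by
  refine Subtype.ext (funext fun μ => ?_)
  rw [cornerY_apply, pow_zero, Nat.cast_one, one_mul, blk_one]

/-- **THE FLOOR ROWS OF `Δ′_{a,□}(U)`**: at a site with `lev_□ z = 0` (the exterior of the cube sequence) the row is the covariant Laplacian
plus the UNIT MASS transported around the trivial loop: `Δ_UΛ(z) + R(U(Γ_{z,z})·U(Γ_{z,z}))Λ(z)` («(Q′₀λ)(x) = λ(x), x ∈ Λ₀»; in print's
units this is the `a₀η⁻²`-mass with `a₀ = a₁ = a = 1` — (3.24) p. 394 «a_1 = a_0 = a > 0» — read at `η = 1`, the normalisation of `lapSL`).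
[cite: Balaban1984PropagatorsII, (2.14) p.225, p.229; Balaban1985BackgroundPropagators, (3.24) p.394 («a_1 = a_0 = a > 0»)] -/
theorem deltaPrimeACubeY_apply_of_lev_zero (par : SiteParY 𝔸 i) (U : CfgY 𝔸 i) (Λ : SiteY i → 𝔸) {z : SiteY i}
    (h0 : levCubeY i q z = 0) :
    deltaPrimeACubeY i q par U Λ z = lapS i U Λ z + R (par U z z * par U z z) (Λ z) := by
  classical
  rw [deltaPrimeACubeY_apply]
  congr 1
  have hℓ := one_le_ell i
  have hco : ∀ w, ((avgCoeffCubeY i q z w : ℝ) : ℂ) • R (avgTrCubeY i q par U z w) (Λ w) =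
      if w = z then R (par U z z * par U z z) (Λ z) else 0 := by
    intro w
    unfold avgCoeffCubeY avgTrCubeY
    rw [h0, levC_zero, wCube_zero hℓ, pow_zero, cornerY_zero]
    unfold avgK
    rw [blk_one, blk_one]
    by_cases hw : w = z
    · subst hw; rw [if_pos rfl, if_pos rfl, Complex.ofReal_one, one_smul]
    · rw [if_neg (fun h => hw (Subtype.ext h)), if_neg hw, Complex.ofReal_zero, zero_smul]
  rw [Finset.sum_congr rfl fun w _ => hco w, Finset.sum_ite_eq' Finset.univ z, if_pos (Finset.mem_univ z)]

end DeltaPrime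

/-! ## §3 The printed `U = 1` clauses and the genuine letter `G′_□(U) = (Δ′_{a,□}(U))⁻¹` -/

section AtOne

variable (i : KIdx d ℓ hd hL b₀ b₁) (q : ↥(cubes (toKT i).D.toDomains))

/-- the cube sequence's matrix `Δ′_{a,□}` on the torus is the periodic Laplacian plus the averaging coefficient matrix (entrywise, the `…L0`
lineage's `mlOpT_apply`). [cite: Balaban1984PropagatorsII, (2.13)–(2.14) p.225] -/
theorem mlOpT_eq_perLapT_add_avgCoeffCubeY :
    mlOpT (toKT i).NB ℓ (toKT i).k (cubeFamY i q).lev (wCube ℓ) = perLapT (toKT i).NB + Matrix.of (avgCoeffCubeY i q) := by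
  ext z w
  rw [B6MultiLevelTorusOperatorL0.mlOpT_apply (cubeFamY i q) rfl (wCube ℓ) z w, Matrix.add_apply, Matrix.of_apply]
  rfl

/-- ★★ **THE PRINTED `U = 1` CLAUSE FOR `Δ′_{a,□}`**: at the trivial configuration, for any transporter letter with `par 1 = 1`, the cube-local
covariant operator IS the lift of the [4]-matrix `mlOpT` of the cube family at the weights `wCube` (as operators).
[cite: Balaban1985BackgroundPropagators, p.395 («It coincides with Δ_a … if U = 1»), Cor. 3.5 p.407, p.409; Balaban1984PropagatorsII, (2.13)–(2.14) p.225] -/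
theorem deltaPrimeACubeY_one (par : SiteParY 𝔸 i) (hpar : ∀ z w, par (fun _ _ => 1) z w = 1) :
    deltaPrimeACubeY i q par (fun _ _ => 1) = liftOpY 𝔸 (mlOpT (toKT i).NB ℓ (toKT i).k (cubeFamY i q).lev (wCube ℓ)) := by
  have htr : avgTrCubeY i q par (fun _ _ => 1) = fun _ _ => (1 : 𝔸ˣ) :=
    funext fun z => funext fun w => avgTrCubeY_one i q par hpar z w
  rw [deltaPrimeACubeY, htr, kernelTrOpY_one, lapSL_one, mlOpT_eq_perLapT_add_avgCoeffCubeY, liftOpY_add]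

/-- the `U = 1` face on product-form arguments: `Δ′_{a,□}(1)(f ⊗ E) = (Δ′_{a,□} f) ⊗ E`. [cite: Balaban1985BackgroundPropagators, p.395; Balaban1984PropagatorsII, (2.13)–(2.14) p.225] -/
theorem deltaPrimeACubeY_one_liftY (par : SiteParY 𝔸 i) (hpar : ∀ z w, par (fun _ _ => 1) z w = 1) (f : SiteY i → ℝ) (E : 𝔸) :
    deltaPrimeACubeY i q par (fun _ _ => 1) (liftY f E) =
      liftY (mlOpT (toKT i).NB ℓ (toKT i).k (cubeFamY i q).lev (wCube ℓ) *ᵥ f) E := by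
  rw [deltaPrimeACubeY_one i q par hpar, liftOpY_liftY]

/-- `Δ′_{a,□}·G′_□(1) = 1` for the cube family of def-Y's member (file 2's `mlOpT_mul_GpCubeW`). [cite: Balaban1984PropagatorsII, p.225 («G′ = Δ′_a^{−1}»)] -/
theorem mlOpT_mul_GpCubeW_toKT :
    mlOpT (toKT i).NB ℓ (toKT i).k (cubeFamY i q).lev (wCube ℓ) * GpCubeW (toKT i).D q hL.1 (oddMh i) (toKT i).hMh (toKT i).hP = 1 :=
  mlOpT_mul_GpCubeW (one_le_ell i) (toKT i).D q hL.1 (oddMh i) (toKT i).hMh (toKT i).hP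

/-- the cube family's `Δ′_{a,□}` matrix is a unit. [cite: Balaban1984PropagatorsII, p.225 («G′ = Δ′_a^{−1} is a well defined, positive operator»)] -/
theorem isUnit_mlOpT_cube : IsUnit (mlOpT (toKT i).NB ℓ (toKT i).k (cubeFamY i q).lev (wCube ℓ)) :=
  isUnit_iff_exists.2 ⟨_, mlOpT_mul_GpCubeW_toKT i q, mul_eq_one_comm.1 (mlOpT_mul_GpCubeW_toKT i q)⟩

/-- at `U = 1`, `Δ′_{a,□}(1)` is invertible. [cite: Balaban1985BackgroundPropagators, p.395, Cor. 3.5 p.407; Balaban1984PropagatorsII, p.225] -/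
theorem isUnit_deltaPrimeACubeY_one (par : SiteParY 𝔸 i) (hpar : ∀ z w, par (fun _ _ => 1) z w = 1) :
    IsUnit (deltaPrimeACubeY i q par (fun _ _ => 1)) :=
  isUnit_of_liftY_clause_mulVec (isUnit_mlOpT_cube i q) (deltaPrimeACubeY_one_liftY i q par hpar)

/-- ★★ **THE GENUINE CUBE LETTER `G′_□(U) = (Δ′_{a,□}(U))⁻¹`** (p. 409 «G′_□(U)»; p. 395 «Its inverse is denoted by G′(U)»): `Ring.inverse` in
`End_ℂ(SiteY → 𝔸)` — the two-sided inverse where `Δ′_{a,□}(U)` is invertible (the regime of Thm 3.1 ∕ Cor. 3.6), `0` elsewhere; a `SiteOpY`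
(the slot type of `B9CubeLettersInvReadings.kernelFamilySInv`). [cite: Balaban1985BackgroundPropagators, (3.25) p.394, p.395 («G′(U)»), p.409, Cor. 3.6 p.408] -/
def GpCubeY (par : SiteParY 𝔸 i) : SiteOpY 𝔸 i := fun U => Ring.inverse (deltaPrimeACubeY i q par U)

/-- `Δ′_{a,□}(U)·G′_□(U) = 1` wherever `Δ′_{a,□}(U)` is invertible. [cite: Balaban1985BackgroundPropagators, p.395, p.409] -/
theorem deltaPrimeACubeY_mul_GpCubeY (par : SiteParY 𝔸 i) (U : CfgY 𝔸 i) (hU : IsUnit (deltaPrimeACubeY i q par U)) :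
    deltaPrimeACubeY i q par U * GpCubeY i q par U = 1 :=
  Ring.mul_inverse_cancel _ hU

/-- `G′_□(U)·Δ′_{a,□}(U) = 1` wherever `Δ′_{a,□}(U)` is invertible. [cite: Balaban1985BackgroundPropagators, p.395, p.409] -/
theorem GpCubeY_mul_deltaPrimeACubeY (par : SiteParY 𝔸 i) (U : CfgY 𝔸 i) (hU : IsUnit (deltaPrimeACubeY i q par U)) :
    GpCubeY i q par U * deltaPrimeACubeY i q par U = 1 :=
  Ring.inverse_mul_cancel _ hU

/-- ★★ **THE PRINTED `U = 1` CLAUSE FOR `G′_□`** (Cor. 3.5 p. 407 «For operators with … U = 1, these theorems are proved in [4]»): `G′_□(1)` IS the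
lift of the [4]-matrix `GpCubeW = gmlT(cubeFam, wCube) = Δ′_{a,□}⁻¹` of file 2 (as operators).
[cite: Balaban1985BackgroundPropagators, Cor. 3.5 p.407, p.395, p.409; Balaban1984PropagatorsII, p.225] -/
theorem GpCubeY_one (par : SiteParY 𝔸 i) (hpar : ∀ z w, par (fun _ _ => 1) z w = 1) :
    GpCubeY i q par (fun _ _ => 1) = liftOpY 𝔸 (GpCubeW (toKT i).D q hL.1 (oddMh i) (toKT i).hMh (toKT i).hP) :=
  eq_liftOpY_of_ringInverse rfl (mlOpT_mul_GpCubeW_toKT i q) (deltaPrimeACubeY_one_liftY i q par hpar)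

/-- `G′_□(1)(f ⊗ E) = (G′_□ f) ⊗ E` (the `Gp_one`-shaped clause). [cite: Balaban1985BackgroundPropagators, Cor. 3.5 p.407, p.409; Balaban1984PropagatorsII, Prop. 2.2 p.234] -/
theorem GpCubeY_one_liftY (par : SiteParY 𝔸 i) (hpar : ∀ z w, par (fun _ _ => 1) z w = 1) (f : SiteY i → ℝ) (E : 𝔸) :
    GpCubeY i q par (fun _ _ => 1) (liftY f E) =
      liftY (GpCubeW (toKT i).D q hL.1 (oddMh i) (toKT i).hMh (toKT i).hP *ᵥ f) E :=
  clause_of_ringInverse_mulVec rfl (mlOpT_mul_GpCubeW_toKT i q) (deltaPrimeACubeY_one_liftY i q par hpar) f E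

end AtOne

/-! ## §4 The row agreement `Δ′_{a,□}(U) = Δ′_a(U)` near □ (the `hloc` input of (3.88)) -/

section RowAgreement

variable (i : KIdx d ℓ hd hL b₀ b₁) (q : ↥(cubes (toKT i).D.toDomains))

/-- **NEAR □ THE CUBE LEVEL IS THE MEMBER'S LEVEL** (file 1's `lev_cubeFam_eq_of_nearH`, every case of the cover).
[cite: Balaban1985BackgroundPropagators, p.408 (□³ ⊂ Ω_j(□)), (3.88) p.409; Balaban1984PropagatorsII, (2.2) p.224] -/
theorem levCubeY_eq_levY_of_nearH {z : SiteY i} (hz : NearH q z.1) : levCubeY i q z = levY i z :=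
  lev_cubeFam_eq_of_nearH (two_le_R i) z.2 hz

/-- at the member's levels (all `≥ 1`) the cube weight IS the member's weight `a_j`. [cite: Balaban1984PropagatorsII, (2.14) p.225, bookkeeping] -/
theorem wCube_levY (z : SiteY i) : wCube ℓ (levY i z) = aPrinted ℓ 1 (levY i z) :=
  wCube_of_one_le ((toKT i).D.one_le_lev z.1)

/-- **NEAR □ THE AVERAGING COEFFICIENTS AGREE**: `avgCoeffCubeY i q z = avgCoeffY i z` (as rows).
[cite: Balaban1985BackgroundPropagators, (3.24) p.394, (3.88) p.409] -/
theorem avgCoeffCubeY_eq_of_nearH {z : SiteY i} (hz : NearH q z.1) (w : SiteY i) :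
    avgCoeffCubeY i q z w = avgCoeffY i z w := by
  unfold avgCoeffCubeY avgCoeffY levC
  rw [levCubeY_eq_levY_of_nearH i q hz, wCube_levY]

/-- **NEAR □ THE AVERAGING TRANSPORTERS AGREE**: `avgTrCubeY i q par U z = avgTrY i par U z` (as rows).
[cite: Balaban1985BackgroundPropagators, (3.19) p.393, (3.88) p.409] -/
theorem avgTrCubeY_eq_of_nearH (par : SiteParY 𝔸 i) (U : CfgY 𝔸 i) {z : SiteY i} (hz : NearH q z.1) (w : SiteY i) :
    avgTrCubeY i q par U z w = avgTrY i par U z w := by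
  unfold avgTrCubeY avgTrY
  rw [levCubeY_eq_levY_of_nearH i q hz]

/-- ★★ **THE ROW AGREEMENT `(Δ′_{a,□}(U)Λ)(z) = (Δ′_a(U)Λ)(z)` FOR `z` NEAR □** — every transporter letter `par`, every configuration `U`, every
`Λ`: the identity behind «Δ′_aG′₀ = I − Σ_□ K(h_□)G′_□h_□» of (3.88) (`Δ′_a G′_□ h_□ = Δ′_{a,□} G′_□ h_□ = h_□` on `supp h_□ ⊂ NearH`).
[cite: Balaban1985BackgroundPropagators, (3.88) p.409, (3.24) p.394] -/
theorem deltaPrimeACubeY_apply_eq_of_nearH (par : SiteParY 𝔸 i) (U : CfgY 𝔸 i) (Λ : SiteY i → 𝔸) {z : SiteY i}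
    (hz : NearH q z.1) : deltaPrimeACubeY i q par U Λ z = deltaPrimeAY i par U Λ z := by
  rw [deltaPrimeACubeY_apply, deltaPrimeAY_apply]
  refine congrArg _ (Finset.sum_congr rfl fun w _ => ?_)
  rw [avgCoeffCubeY_eq_of_nearH i q hz, avgTrCubeY_eq_of_nearH i q par U hz]

/-- ★ THE CUT-OFF FORM: for a real cut-off `h` supported near □ (e.g. `h_□` of (3.87)), `h·(Δ′_{a,□}(U)Λ) = h·(Δ′_a(U)Λ)` as functions.
[cite: Balaban1985BackgroundPropagators, (3.87)–(3.88) p.409] -/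
theorem cutoff_deltaPrimeACubeY_eq (par : SiteParY 𝔸 i) (U : CfgY 𝔸 i) (h : SiteY i → ℝ)
    (hh : ∀ z, h z ≠ 0 → NearH q z.1) (Λ : SiteY i → 𝔸) :
    (fun z => ((h z : ℝ) : ℂ) • deltaPrimeACubeY i q par U Λ z) = fun z => ((h z : ℝ) : ℂ) • deltaPrimeAY i par U Λ z := by
  funext z
  by_cases hz : h z = 0
  · rw [hz, Complex.ofReal_zero, zero_smul, zero_smul]
  · rw [deltaPrimeACubeY_apply_eq_of_nearH i q par U Λ (hh z hz)]

end RowAgreement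

end

end Literature.MathematicalPhysics.QuantumFieldTheory.Balaban1983to89.B9CubeLettersOpsL0
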